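import Summits.Ventures.GridStability.Models.SMIBClearingThresholdK13

/-!
# GridStability/Models/SMIBPoleSlipK13 — KERNEL UPPER BOUND on the clearing time of «SMIB-K13post-D10»: clearing at `t_cl = 0.135 s` ⇒ pole slip (line «G1cct-SMIB-UPPER-K»)

Cell `gridfusion` (LADDER-GRIDFUSION G1.SMIB / sub-rung G1-cct; lead RULING R-CCT-UPPER-SMIB
2026-08-27T06:20:38Z), seat gridfusion-model-1.  THREE COLUMNS: an a-priori kernel theorem about
the typed MODEL M′_SMIB (MODELLED: classical SMIB `SMIB.K13postD10`, MV-1 + MV-P + MV-KD; zero-power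
fault-on record `SMIB.K13fault (10/377)` = Kundur Ex. 13.1 fault with the `K_D = 10` damping in force
[cite: Kundur1994, Example 13.1 and Example 12.2 (iii)]; pre-fault angle declared in
`[0.7290, 0.7291]` rad around the printed `41.77°`).  No solver, no enclosure engine, no certnum
object: closed-form bounds + rational trigonometric enclosures + lit-1's unstable-side energy
criterion `SMIB.poleSlip_of_excessEnergy` (p504520, [cite: SauerPai1998, §9.6.2, text after (9.36)]).

## What is certified

* `SMIBOrbit.faultOn_bounds4` — generic two-sided bounds along the zero-power fault-on arc
  `δ̇ = ω`, `ω̇ = a − kω` from rest (`a, k ≥ 0`): for every `t ∈ [0, T]`,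
  `a t − a k t²/2 + a k² t³/6 − a k³ t⁴/24 ≤ ω(t) ≤ a t − a k t²/2 + a k² t³/6` and
  `δ₀ + a t²/2 − a k t³/6 ≤ δ(t) ≤ δ₀ + a t²/2` (successive «non-negative derivative ⇒ monotone»
  steps; the partial sums of `(a/k)(1 − e^{−kt})`);
* `SMIB.deltaK13_gt'` — `0.9551 < δˢ`; `SMIB.K13postD10_criticalEnergy_lt` — `V_cr < 0.165169`;
* `SMIB.K13postD10_poleSlip_of_clearing_0135` — **for every fault-on motion `Y` of `K13fault (10/377)`
  on `[0, 0.135]` from `δ₀ ∈ [0.7290, 0.7291]`, `ω₀ = 0`, and EVERY global post-fault solution `X` of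
  `K13postD10` with `X 0 = Y(0.135)`: at some `t ≥ 0`, `δ(t) − δˢ > π` (pole slip).**  Certified
  ingredients at `t_cl = 27/200`: `ω_c ∈ [5.951, 5.9533]`, `δ_c ∈ [1.1423, 1.1708]`, `cos 1.1423 ≤
  cosUpper4`, excess `m = 1/1000` (kernel margin ≈ 0.0078 on top).

THE CCT TIER THEN READS (numbers never merged): `0.0866 s` energy threshold (kernel) < `0.112 s` SOS
threshold (kernel) ≤ `0.1163 s` endpoint (kernel ∘ enclosure) ≤ bracket `[0.117, 0.1175) s`
(composition) < **`0.135 s` pole slip (kernel, this file)**; the 17 ms between `0.1175` and `0.135` is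
the damper-work allowance `D ω_c (δ^u − δ_c)` of the criterion, not a statement about M′.
VALIDATED (floats, not used): closed-form `ω_c = 5.9513`, `δ_c = 1.1437`, margin `m(0.135) = +0.009`
(lit-1 06:19:49Z).  No sentence here says a machine or a grid is stable or unstable.
-/

noncomputable section

open Real Set Filter Topology

namespace Summit.Ventures.GridStability.Models.SMIBOrbit

/-- Private helper: non-negative within-derivative on `[0, T]` and value `0` at `0` give
non-negative values on `[0, T]`. [folklore] -/
private theorem nonneg_of_deriv_nonneg {g g' : ℝ → ℝ} {T : ℝ}
    (hg : ∀ s ∈ Icc 0 T, HasDerivWithinAt g (g' s) (Icc 0 T) s)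
    (hpos : ∀ s ∈ Icc 0 T, 0 ≤ g' s) (h0 : g 0 = 0) {t : ℝ} (ht : t ∈ Icc 0 T) : 0 ≤ g t := by
  have hmono : MonotoneOn g (Icc 0 T) :=
    monotoneOn_of_hasDerivWithinAt_nonneg (convex_Icc 0 T) (fun s hs => (hg s hs).continuousWithinAt)
      (fun s hs => (hg s (interior_subset hs)).mono interior_subset)
      (fun s hs => hpos s (interior_subset hs))
  have h := hmono ⟨le_rfl, ht.1.trans ht.2⟩ ht ht.1
  rwa [h0] at h

/-- **Two-sided closed-form bounds along the zero-power fault-on arc** `δ̇ = ω`, `ω̇ = a − kω`,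
`ω(0) = 0` (`a, k ≥ 0`; `a = P_m/M`, `k = D_f/M`): on `[0, T]`,
`a t − a k t²/2 + a k² t³/6 − a k³ t⁴/24 ≤ ω(t) ≤ a t − a k t²/2 + a k² t³/6` and
`δ(0) + a t²/2 − a k t³/6 ≤ δ(t) ≤ δ(0) + a t²/2` — the alternating partial sums of
`ω = (a/k)(1 − e^{−kt})`, each obtained from the previous one by one sign-of-derivative step.
[cite: Kundur1994, Example 13.1] -/
theorem faultOn_bounds4 {a k T : ℝ} (ha : 0 ≤ a) (hk : 0 ≤ k) {δF ωF : ℝ → ℝ}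
    (hδ : ∀ t ∈ Icc 0 T, HasDerivWithinAt δF (ωF t) (Icc 0 T) t)
    (hω : ∀ t ∈ Icc 0 T, HasDerivWithinAt ωF (a - k * ωF t) (Icc 0 T) t) (hω0 : ωF 0 = 0)
    {t : ℝ} (ht : t ∈ Icc 0 T) :
    (a * t - a * k * t ^ 2 / 2 + a * k ^ 2 * t ^ 3 / 6 - a * k ^ 3 * t ^ 4 / 24 ≤ ωF t ∧
      ωF t ≤ a * t - a * k * t ^ 2 / 2 + a * k ^ 2 * t ^ 3 / 6) ∧
    (δF 0 + a * t ^ 2 / 2 - a * k * t ^ 3 / 6 ≤ δF t ∧ δF t ≤ δF 0 + a * t ^ 2 / 2) := by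
  -- polynomial derivatives (within [0, T])
  have hP1 : ∀ s ∈ Icc 0 T, HasDerivWithinAt (fun s : ℝ => a * s) a (Icc 0 T) s := fun s _ => by
    simpa using ((hasDerivAt_id s).const_mul a).hasDerivWithinAt (s := Icc 0 T)
  have hP2 : ∀ s ∈ Icc 0 T, HasDerivWithinAt (fun s : ℝ => a * s - a * k * s ^ 2 / 2)
      (a - a * k * s) (Icc 0 T) s := fun s _ => by
    have h := (((hasDerivAt_id s).const_mul a).sub
      (((hasDerivAt_pow 2 s).const_mul (a * k)).div_const 2)).hasDerivWithinAt (s := Icc 0 T)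
    refine (h.congr_deriv ?_).congr (fun x _ => by simp) (by simp)
    push_cast; ring
  have hP3 : ∀ s ∈ Icc 0 T, HasDerivWithinAt
      (fun s : ℝ => a * s - a * k * s ^ 2 / 2 + a * k ^ 2 * s ^ 3 / 6)
      (a - a * k * s + a * k ^ 2 * s ^ 2 / 2) (Icc 0 T) s := fun s hs => by
    have h := (hP2 s hs).add
      ((((hasDerivAt_pow 3 s).const_mul (a * k ^ 2)).div_const 6).hasDerivWithinAt (s := Icc 0 T))
    refine h.congr_deriv ?_
    push_cast; ring
  have hP4 : ∀ s ∈ Icc 0 T, HasDerivWithinAt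
      (fun s : ℝ => a * s - a * k * s ^ 2 / 2 + a * k ^ 2 * s ^ 3 / 6 - a * k ^ 3 * s ^ 4 / 24)
      (a - a * k * s + a * k ^ 2 * s ^ 2 / 2 - a * k ^ 3 * s ^ 3 / 6) (Icc 0 T) s := fun s hs => by
    have h := (hP3 s hs).sub
      ((((hasDerivAt_pow 4 s).const_mul (a * k ^ 3)).div_const 24).hasDerivWithinAt (s := Icc 0 T))
    refine h.congr_deriv ?_
    push_cast; ring
  have hQ2 : ∀ s ∈ Icc 0 T, HasDerivWithinAt (fun s : ℝ => a * s ^ 2 / 2) (a * s) (Icc 0 T) s :=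
    fun s _ => by
    have h := (((hasDerivAt_pow 2 s).const_mul a).div_const 2).hasDerivWithinAt (s := Icc 0 T)
    refine h.congr_deriv ?_
    push_cast; ring
  have hQ3 : ∀ s ∈ Icc 0 T, HasDerivWithinAt (fun s : ℝ => a * s ^ 2 / 2 - a * k * s ^ 3 / 6)
      (a * s - a * k * s ^ 2 / 2) (Icc 0 T) s := fun s hs => by
    have h := (hQ2 s hs).sub
      ((((hasDerivAt_pow 3 s).const_mul (a * k)).div_const 6).hasDerivWithinAt (s := Icc 0 T))
    refine h.congr_deriv ?_
    push_cast; ring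
  -- (0) ω ≥ 0 via ω e^{kt}
  have hωnn : ∀ s ∈ Icc 0 T, 0 ≤ ωF s := by
    intro s hs
    have hder : ∀ s ∈ Icc 0 T, HasDerivWithinAt (fun s => ωF s * Real.exp (k * s))
        (Real.exp (k * s) * a) (Icc 0 T) s := by
      intro s hs
      have hexp : HasDerivWithinAt (fun s => Real.exp (k * s)) (Real.exp (k * s) * k) (Icc 0 T) s := by
        have hlin : HasDerivAt (fun s : ℝ => k * s) k s := by
          simpa using (hasDerivAt_id s).const_mul k
        exact ((Real.hasDerivAt_exp _).comp s hlin).hasDerivWithinAt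
      refine ((hω s hs).mul hexp).congr_deriv ?_
      ring
    have h := nonneg_of_deriv_nonneg hder (fun s _ => mul_nonneg (Real.exp_pos _).le ha)
      (by simp [hω0]) hs
    exact nonneg_of_mul_nonneg_left h (Real.exp_pos _)
  -- (1) ω ≤ a t
  have h1 : ∀ s ∈ Icc 0 T, ωF s ≤ a * s := by
    intro s hs
    have h := nonneg_of_deriv_nonneg (g := fun s => a * s - ωF s)
      (fun s hs => (hP1 s hs).sub (hω s hs)) (fun s hs => by
        have := hωnn s hs; nlinarith) (by simp [hω0]) hs
    linarith
  -- (2) ω ≥ a t − a k t²/2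
  have h2 : ∀ s ∈ Icc 0 T, a * s - a * k * s ^ 2 / 2 ≤ ωF s := by
    intro s hs
    have h := nonneg_of_deriv_nonneg (g := fun s => ωF s - (a * s - a * k * s ^ 2 / 2))
      (fun s hs => (hω s hs).sub (hP2 s hs)) (fun s hs => by
        have := h1 s hs
        have : 0 ≤ k * (a * s - ωF s) := mul_nonneg hk (by linarith)
        nlinarith) (by simp [hω0]) hs
    linarith
  -- (3) ω ≤ a t − a k t²/2 + a k² t³/6
  have h3 : ∀ s ∈ Icc 0 T, ωF s ≤ a * s - a * k * s ^ 2 / 2 + a * k ^ 2 * s ^ 3 / 6 := by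
    intro s hs
    have h := nonneg_of_deriv_nonneg
      (g := fun s => a * s - a * k * s ^ 2 / 2 + a * k ^ 2 * s ^ 3 / 6 - ωF s)
      (fun s hs => (hP3 s hs).sub (hω s hs)) (fun s hs => by
        have := h2 s hs
        have : 0 ≤ k * (ωF s - (a * s - a * k * s ^ 2 / 2)) := mul_nonneg hk (by linarith)
        nlinarith) (by simp [hω0]) hs
    linarith
  -- (4) ω ≥ … − a k³ t⁴/24
  have h4 : ∀ s ∈ Icc 0 T,
      a * s - a * k * s ^ 2 / 2 + a * k ^ 2 * s ^ 3 / 6 - a * k ^ 3 * s ^ 4 / 24 ≤ ωF s := by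
    intro s hs
    have h := nonneg_of_deriv_nonneg
      (g := fun s => ωF s - (a * s - a * k * s ^ 2 / 2 + a * k ^ 2 * s ^ 3 / 6 - a * k ^ 3 * s ^ 4 / 24))
      (fun s hs => (hω s hs).sub (hP4 s hs)) (fun s hs => by
        have := h3 s hs
        have : 0 ≤ k * (a * s - a * k * s ^ 2 / 2 + a * k ^ 2 * s ^ 3 / 6 - ωF s) :=
          mul_nonneg hk (by linarith)
        nlinarith) (by simp [hω0]) hs
    linarith
  -- (5) δ ≥ δ₀ + a t²/2 − a k t³/6 and (6) δ ≤ δ₀ + a t²/2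
  have h5 : δF 0 + a * t ^ 2 / 2 - a * k * t ^ 3 / 6 ≤ δF t := by
    have h := nonneg_of_deriv_nonneg
      (g := fun s => δF s - δF 0 - (a * s ^ 2 / 2 - a * k * s ^ 3 / 6))
      (fun s hs => ((hδ s hs).sub_const (δF 0)).sub (hQ3 s hs)) (fun s hs => by
        have := h2 s hs; linarith) (by simp) ht
    linarith
  have h6 : δF t ≤ δF 0 + a * t ^ 2 / 2 := by
    have h := nonneg_of_deriv_nonneg (g := fun s => δF 0 + a * s ^ 2 / 2 - δF s)
      (fun s hs => ((hQ2 s hs).const_add (δF 0)).sub (hδ s hs)) (fun s hs => by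
        have := h1 s hs; linarith) (by simp) ht
    linarith
  exact ⟨⟨h4 t ht, h3 t ht⟩, h5, h6⟩

end Summit.Ventures.GridStability.Models.SMIBOrbit

namespace Summit.Ventures.GridStability.Models.SMIB

open AngleEnclosure in
/-- Certified lower bound `0.9551 < δˢ` (sharper than `deltaK13_gt`'s `0.955`; chain with five
doublings, `cos δˢ = c*`). -/
theorem deltaK13_gt' : (9551 / 10000 : ℝ) < deltaK13 := by
  have hc : cos (arcsin (2899575 / 3551657 : ℝ)) = 2051032 / 3551657 := by
    have h := cos_deltaK13
    simp only [deltaK13, sStar, cStar] at h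
    push_cast at h
    exact h
  have h : (9551 / 10000 : ℝ) < arcsin (2899575 / 3551657 : ℝ) := by
    refine arcsin_gt_of_chain5 hc (by norm_num) (by linarith [pi_gt_three]) ?_ ?_ ?_ ?_ ?_ ?_ <;>
      norm_num [dbl, cosLower5]
  have hd : deltaK13 = arcsin (2899575 / 3551657 : ℝ) := by
    simp only [deltaK13, sStar]; push_cast; rfl
  rw [hd]; exact h

/-- **Certified rational over-approximation of the critical energy: `V_cr < 0.165169`** (float
`0.165078`; from `δˢ < 0.9552` and `π > 3.141592`). -/
theorem K13postD10_criticalEnergy_lt :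
    K13postD10.toLit.criticalEnergy deltaK13 < 165169 / 1000000 := by
  rw [K13postD10_criticalEnergy_eq]
  have hπ := Real.pi_gt_d6
  have hδ := deltaK13_lt
  norm_num [cStar] at hπ hδ ⊢
  nlinarith

/-- **KERNEL UPPER BOUND ON THE CLEARING TIME OF M′_SMIB: clearing at `t_cl = 0.135 s` ⇒ pole slip.**
MODELLED: classical SMIB `M_smib` (MV-1 + MV-P + MV-KD): post-fault record `K13postD10`
(`M = 7/377`, `D = 10/377`, `P_m′ = 79912287/88791425`, `P_M = 689/625`), zero-power fault-on record
`K13fault (10/377)` (the `K_D = 10` damping in force during the fault) [cite: Kundur1994, Example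
13.1 and Example 12.2 (iii)], pre-fault angle `δ₀ ∈ [0.7290, 0.7291]` rad (printed `41.77°`),
`ω₀ = 0`.  STATEMENT: for every fault-on motion `Y` on `[0, 27/200]` and EVERY global post-fault
solution `X` of `K13postD10` (on every `[0, S]`) with `X 0 = Y (27/200)`: there is `t ≥ 0` with
`δ(t) − δˢ > π` — the machine of MODEL M′ loses synchronism when the fault is cleared at `0.135 s`
(the negation of the «`|δ − δˢ| < π` for all `t`» clause of every resynchronisation row).  Proof =
lit-1 `SMIB.poleSlip_of_excessEnergy` (energy above `V_cr` by more than the damper-work allowance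
`D ω_c (δ^u − δ_c)`, `m = 1/1000`) through `SMIB.toLit`, with the cleared state enclosed by
`SMIBOrbit.faultOn_bounds4` (`ω_c ∈ [5.951, 5.9533]`, `δ_c ∈ [1.1423, 1.1708]`), `V_cr < 0.165169`,
`0.9551 < δˢ < 0.9552`, `cos 1.1423 ≤ cosUpper4`.  Two-sided kernel reading of the tier: clearing at
any `t ≤ 0.112 s` resynchronises (#19), clearing at `0.135 s` does not.
[cite: SauerPai1998, §9.6.2 (text after (9.36)) and §9.6.3 (9.48); Kundur1994, §13.1.3] -/
theorem K13postD10_poleSlip_of_clearing_0135 {Y : ℝ → ℝ × ℝ}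
    (hY : (K13fault (10 / 377)).IsSolutionOn Y (Icc 0 (27 / 200)))
    (hδ0 : (Y 0).1 ∈ Icc (7290 / 10000 : ℝ) (7291 / 10000)) (hω0 : (Y 0).2 = 0)
    {X : ℝ → ℝ × ℝ} (hX0 : X 0 = Y (27 / 200)) (hX : ∀ S : ℝ, K13postD10.IsSolutionOn X (Icc 0 S)) :
    ∃ t : ℝ, 0 ≤ t ∧ π < (X t).1 - deltaK13 := by
  -- the cleared state, enclosed
  obtain ⟨hδ, hω⟩ := K13fault_scalar hY
  have hω' : ∀ t ∈ Icc (0 : ℝ) (27 / 200), HasDerivWithinAt (fun s => (Y s).2)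
      ((4303847457 / 88791425 : ℝ) - (10 / 7 : ℝ) * (fun s => (Y s).2) t) (Icc 0 (27 / 200)) t := by
    intro t ht
    refine (hω t ht).congr_deriv ?_
    ring
  have hT : (27 / 200 : ℝ) ∈ Icc (0 : ℝ) (27 / 200) := ⟨by norm_num, le_rfl⟩
  obtain ⟨⟨hωlo, hωhi⟩, hδlo, hδhi⟩ := SMIBOrbit.faultOn_bounds4 (by norm_num) (by norm_num) hδ hω'
    hω0 hT
  have hδ01 := hδ0.1
  have hδ02 := hδ0.2
  have hωc_lo : (5951 / 1000 : ℝ) ≤ (Y (27 / 200)).2 := le_trans (by norm_num) hωlo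
  have hωc_hi : (Y (27 / 200)).2 ≤ 59533 / 10000 := le_trans hωhi (by norm_num)
  have hδc_lo : (11423 / 10000 : ℝ) ≤ (Y (27 / 200)).1 := by
    refine le_trans ?_ hδlo
    norm_num at hδ01 ⊢; linarith
  have hδc_hi : (Y (27 / 200)).1 ≤ 11708 / 10000 := by
    refine le_trans hδhi ?_
    norm_num at hδ02 ⊢; linarith
  -- the post-fault record and its facts
  set p := K13postD10.toLit with hp
  have hpv : p = ⟨7 / 377, 10 / 377, 79912287 / 88791425, 689 / 625⟩ := K13postD10_toLit
  have hM : 0 < p.M := by rw [hpv]; norm_num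
  have hD : 0 ≤ p.D := by rw [hpv]; norm_num
  have hPmax : 0 < p.Pmax := by rw [hpv]; norm_num
  have heq : p.IsEquilibriumAngle deltaK13 :=
    (toLit_isEquilibriumAngle_iff K13postD10_γ deltaK13).2 K13postD10_isEquilibrium
  have hXlit : ∀ S : ℝ, ∀ t ∈ Icc 0 S, HasDerivWithinAt X (p.vectorField (X t)) (Icc 0 S) t :=
    fun S => (isSolutionOn_iff_toLit K13postD10_γ X _).1 (hX S)
  have hδs_lo := deltaK13_gt'
  have hδs_hi := deltaK13_lt
  have hπlo := Real.pi_gt_d6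
  have hπhi := Real.pi_lt_d6
  rw [← hX0] at hωc_lo hωc_hi hδc_lo hδc_hi
  have hδc : deltaK13 ≤ (X 0).1 := by norm_num at hδs_hi hδc_lo ⊢; linarith
  have hδcu : (X 0).1 ≤ π - deltaK13 := by norm_num at hδs_hi hδc_hi hπlo ⊢; linarith
  have hωc : 0 < (X 0).2 := by norm_num at hωc_lo ⊢; linarith
  -- the excess inequality
  have hVcr := K13postD10_criticalEnergy_lt
  rw [← hp] at hVcr
  -- potential energy at the cleared angle ≥ its value at 1.1423 ≥ a rational
  have hmono := SMIBOrbit.potentialEnergy_strictMonoOn hPmax heq deltaK13_pos.le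
    deltaK13_lt_pi_div_two.le
  have hPE1 : p.potentialEnergy deltaK13 (11423 / 10000) ≤ p.potentialEnergy deltaK13 (X 0).1 := by
    refine hmono.monotoneOn ⟨?_, ?_⟩ ⟨hδc, hδcu⟩ hδc_lo
    · norm_num at hδs_hi ⊢; linarith
    · norm_num at hδs_hi hπlo ⊢; linarith
  have hcos : cos (11423 / 10000 : ℝ) ≤ AngleEnclosure.cosUpper4 (11423 / 10000) :=
    AngleEnclosure.cos_le_cosUpper4 (by norm_num) (by linarith [pi_gt_three])
  have hPE2 : (10027 / 1000000 : ℝ) ≤ p.potentialEnergy deltaK13 (11423 / 10000) := by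
    rw [hpv]
    unfold Literature.MathematicalPhysics.PowerSystems.SMIB.potentialEnergy
    rw [cos_deltaK13]
    simp only [cStar]
    push_cast
    norm_num [AngleEnclosure.dbl, AngleEnclosure.cosUpper4] at hcos hδs_lo ⊢
    nlinarith
  have hKE : (1 : ℝ) / 2 * (7 / 377) * (5951 / 1000) ^ 2 ≤ 1 / 2 * p.M * (X 0).2 ^ 2 := by
    rw [hpv]
    dsimp only
    nlinarith
  have hallow : p.D * (X 0).2 * (π - deltaK13 - (X 0).1) ≤
      (10 / 377 : ℝ) * (59533 / 10000) * (3141593 / 1000000 - 9551 / 10000 - 11423 / 10000) := by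
    rw [hpv]
    dsimp only
    have h1 : 0 ≤ π - deltaK13 - (X 0).1 := by linarith
    have h2 : π - deltaK13 - (X 0).1 ≤ 3141593 / 1000000 - 9551 / 10000 - 11423 / 10000 := by
      norm_num at hπhi hδs_lo hδc_lo ⊢; linarith
    have h3 : (0 : ℝ) ≤ (X 0).2 := hωc.le
    calc (10 / 377 : ℝ) * (X 0).2 * (π - deltaK13 - (X 0).1)
        ≤ (10 / 377 : ℝ) * (59533 / 10000) * (π - deltaK13 - (X 0).1) := by
          apply mul_le_mul_of_nonneg_right _ h1
          exact mul_le_mul_of_nonneg_left hωc_hi (by norm_num)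
      _ ≤ (10 / 377 : ℝ) * (59533 / 10000) * (3141593 / 1000000 - 9551 / 10000 - 11423 / 10000) :=
          mul_le_mul_of_nonneg_left h2 (by norm_num)
  have hexcess : p.criticalEnergy deltaK13 + 1 / 1000 + p.D * (X 0).2 * (π - deltaK13 - (X 0).1) ≤
      p.energy deltaK13 (X 0) := by
    have hE : p.energy deltaK13 (X 0) = 1 / 2 * p.M * (X 0).2 ^ 2 +
        p.potentialEnergy deltaK13 (X 0).1 := rfl
    rw [hE]
    norm_num at hVcr hPE2 hKE hallow ⊢
    linarith
  exact p.poleSlip_of_excessEnergy hM hD hPmax heq deltaK13_pos.le deltaK13_lt_pi_div_two hXlit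
    hδc hδcu hωc (by norm_num : (0 : ℝ) < 1 / 1000) hexcess

end Summit.Ventures.GridStability.Models.SMIB

end
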